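import Summits.NavierStokesRegularity.NavierStokesRegularity.Theorems.LerayQuarterDissipationRecurrentReductionDKernel
import Summits.NavierStokesRegularity.NavierStokesRegularity.Theorems.LerayQuarterDissipationRecurrentReductionDKernelHolder
import Literature.Analysis.FluidPDE.TypeIAncientMild
import HarnessLib

/-!
# Route `LerayQuarterDissipation`, item `RecurrentReductionD` (stmt-NavierStokesRegularity-22507):
# sup-norm ε-regularity for `𝒟`, Stage 2 — induction step B (rings)

Helper file (theorems only, `--supports` the item). Stage 1 leaves a Type-I ancient mild field
`v` (constant `C`, slices in `L⁶` with `‖v(τ)‖₆ ≤ k₆(−τ)^{−1/4}`) with a Type-I-SMALL bound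
`‖v‖ ≤ a + η₀(−τ)^{−1/2}` on the parabolic region `Ω₀ = {‖y‖ < R + M√(−τ)}`, `t₁ < τ < 0`.
Stage 2 converts this into an absolute bound by an induction over nested regions
`Ω_n = {‖y‖ < R_n + M√(−τ)}` with invariants `(A_n)` `‖v‖ ≤ a + η_n(−τ)^{−1/2}` on `Ω_n` and
`(B_n)` "the Duhamel influence of the shell `Ω₀ ∖ Ω_n` on `{|v| > 2a}` is `≤ (a/4)(1 − 2^{−n})`
at the points of `Ω_{n+1}`". Step B is proved here (generic radii), step A in the companion file `…Stage2A`: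

* `stage2_stepA` — `(A_n) ∧ (B_n) ⇒ (A_{n+1})`: at `(t,x)` with `‖x‖ < R' + M√(−t)`,
  `R' ≤ R_n`, `R' ≤ 3R/4`, split `|v|² ≤ 4a² + 1_{|v|>2a}|v|²`; the `4a²` part costs
  `8κ₁a²√(−t₁)`, the excess on `Ω_n` costs `16κ₁η_n²(−t)^{−1/2}` (`|v| ≤ 2η_n(−τ)^{−1/2}` there),
  the shell is the hypothesis, the exterior of `Ω₀` is at distance `≥ R/4` and is paid by the
  `L⁶` law (`lintegral_env_mul_enorm_sq_le`), the heat term is a hypothesis;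
* `stage2_stepB` — the ring `Ω_n ∖ Ω_{n+1}` seen from distance `≥ D` costs
  `8η_n C₀c₃ D^{−3/2} k₆ (−t₁)^{1/4}` (`lintegral_env_mul_enorm_le`).

References: G. Koch, N. Nadirashvili, G. Seregin, V. Šverák, arXiv:0709.3599, §3 (3.8), §4
[KochNadirashviliSereginSverak2009].
-/

noncomputable section

-- the summit and its single problem share the name (D-0017 nested layout)
set_option linter.dupNamespace false

namespace Summit.NavierStokesRegularity.NavierStokesRegularity.Theorems.RecurrentReductionD

open MeasureTheory Set Function Filter Topology Metric
open Literature.Analysis Literature.Analysis.FluidPDE Literature.Analysis.UnboundedOperators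
open scoped ENNReal NNReal

/-- On a region where `‖v‖ ≤ a + η(−τ)^{−1/2}`, the excess `1_{‖v‖>2a}‖v‖²` is at most
`2η(−τ)^{−1/2}‖v‖`. [folklore] -/
theorem excess_le_mul_of_bound {a η τ : ℝ} (hη : 0 ≤ η) (hτ : τ < 0)
    {z : EuclideanSpace ℝ (Fin 3)} (hz : ‖z‖ ≤ a + η * (-τ) ^ (-(1 / 2 : ℝ))) :
    indicator {z : EuclideanSpace ℝ (Fin 3) | 2 * a < ‖z‖} (fun z => ‖z‖ₑ ^ 2) z ≤
      ENNReal.ofReal (2 * η * (-τ) ^ (-(1 / 2 : ℝ))) * ‖z‖ₑ := by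
  by_cases h : 2 * a < ‖z‖
  · rw [indicator_of_mem (show z ∈ {z : EuclideanSpace ℝ (Fin 3) | 2 * a < ‖z‖} from h)]
    have h2 : ‖z‖ ≤ 2 * η * (-τ) ^ (-(1 / 2 : ℝ)) := by linarith
    rw [← ofReal_norm, ← ENNReal.ofReal_pow (norm_nonneg _), ← ENNReal.ofReal_mul (by
      have := Real.rpow_nonneg (neg_pos.2 hτ).le (-(1 / 2 : ℝ)); positivity)]
    refine ENNReal.ofReal_le_ofReal ?_
    rw [sq]
    exact mul_le_mul_of_nonneg_right h2 (norm_nonneg _)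
  · rw [indicator_of_notMem (show z ∉ {z : EuclideanSpace ℝ (Fin 3) | 2 * a < ‖z‖} from h)]
    exact bot_le

/-- **Step B of Stage 2** (module docstring): the Duhamel influence of the ring
`{Rn1 + M√(−τ) ≤ ‖y‖ < Rn + M√(−τ)}` restricted to `{|v| > 2a}`, seen from a point `x` with
`‖x‖ < Rn2 + M√(−t)`, `Rn2 + D ≤ Rn1`, given `(A_n)` on the region of radius `Rn`, is at most
`8η_n C₀ c₃ D^{−3/2} k₆ (−t₁)^{1/4}`. [cite: KochNadirashviliSereginSverak2009, §4 p. 8 (arXiv:0709.3599)] -/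
theorem stage2_stepB {C₀ : ℝ} (hC₀ : 0 < C₀)
    {C : ℝ} {v : ℝ → EuclideanSpace ℝ (Fin 3) → EuclideanSpace ℝ (Fin 3)}
    (hv : IsTypeIAncientMild C v) {k₆ : ℝ} (hk₆ : 0 ≤ k₆)
    (hL6 : ∀ τ : ℝ, τ < 0 → eLpNorm (v τ) 6 volume ≤ ENNReal.ofReal (k₆ * (-τ) ^ (-(1 / 4 : ℝ))))
    {t₁ t Rn Rn1 Rn2 D M a ηn : ℝ} (ht₁ : t₁ < t) (ht : t < 0) (hD : 0 < D) (hM : 0 < M)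
    (hηn : 0 ≤ ηn) (hD1 : Rn2 + D ≤ Rn1)
    (hAn : ∀ τ ∈ Ioo t₁ 0, ∀ y : EuclideanSpace ℝ (Fin 3),
      ‖y‖ < Rn + M * Real.sqrt (-τ) → ‖v τ y‖ ≤ a + ηn * (-τ) ^ (-(1 / 2 : ℝ)))
    {x : EuclideanSpace ℝ (Fin 3)} (hx : ‖x‖ < Rn2 + M * Real.sqrt (-t)) :
    ∫⁻ τ in Ioo t₁ t, ∫⁻ y in ball (0 : EuclideanSpace ℝ (Fin 3)) (Rn + M * Real.sqrt (-τ)) \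
        ball 0 (Rn1 + M * Real.sqrt (-τ)),
        ENNReal.ofReal (C₀ * ((t - τ) + ‖x - y‖ ^ 2) ^ (-(2 : ℝ))) *
          indicator {z : EuclideanSpace ℝ (Fin 3) | 2 * a < ‖z‖} (fun z => ‖z‖ₑ ^ 2) (v τ y) ≤
      ENNReal.ofReal (8 * ηn * (C₀ * (3 * (volume : Measure (EuclideanSpace ℝ (Fin 3))).real (ball 0 1) *
        (5 / 9)) ^ (5 / 6 : ℝ)) * D ^ (-(3 / 2 : ℝ)) * k₆ * (-t₁) ^ (1 / 4 : ℝ)) := by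
  set c₃ : ℝ := (3 * (volume : Measure (EuclideanSpace ℝ (Fin 3))).real (ball 0 1) * (5 / 9)) ^
    (5 / 6 : ℝ) with hc₃
  have hc₃0 : 0 ≤ c₃ := by positivity
  have hnt : 0 < -t := neg_pos.2 ht
  -- pointwise in time
  have hslice : ∀ τ ∈ Ioo t₁ t,
      ∫⁻ y in ball (0 : EuclideanSpace ℝ (Fin 3)) (Rn + M * Real.sqrt (-τ)) \ ball 0 (Rn1 + M * Real.sqrt (-τ)),
        ENNReal.ofReal (C₀ * ((t - τ) + ‖x - y‖ ^ 2) ^ (-(2 : ℝ))) *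
          indicator {z : EuclideanSpace ℝ (Fin 3) | 2 * a < ‖z‖} (fun z => ‖z‖ₑ ^ 2) (v τ y) ≤
        ENNReal.ofReal ((2 * ηn * C₀ * c₃ * D ^ (-(3 / 2 : ℝ)) * k₆) * (-τ) ^ (-(3 / 4 : ℝ))) := by
    intro τ hτ
    have hτt : τ < t := hτ.2
    have hτ0 : τ < 0 := hτt.trans ht
    have hnτ : 0 < -τ := neg_pos.2 hτ0
    have hσ : 0 < t - τ := sub_pos.2 hτt
    set Ring : Set (EuclideanSpace ℝ (Fin 3)) :=
      ball (0 : EuclideanSpace ℝ (Fin 3)) (Rn + M * Real.sqrt (-τ)) \ ball 0 (Rn1 + M * Real.sqrt (-τ))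
      with hRing
    -- on the ring: excess ≤ 2ηn(−τ)^{−1/2}‖v‖, and separation `≥ D`
    have hb : ∀ y ∈ Ring, indicator {z : EuclideanSpace ℝ (Fin 3) | 2 * a < ‖z‖} (fun z => ‖z‖ₑ ^ 2) (v τ y) ≤
        ENNReal.ofReal (2 * ηn * (-τ) ^ (-(1 / 2 : ℝ))) * ‖v τ y‖ₑ := by
      intro y hy
      have hy' : ‖y‖ < Rn + M * Real.sqrt (-τ) := by
        have := hy.1; rwa [mem_ball_zero_iff] at this
      exact excess_le_mul_of_bound hηn hτ0 (hAn τ ⟨hτ.1, hτ0⟩ y hy')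
    have hsub : Ring ⊆ (ball x D)ᶜ := by
      intro y hy
      have hy2 : Rn1 + M * Real.sqrt (-τ) ≤ ‖y‖ := by
        have := hy.2; rwa [mem_ball_zero_iff, not_lt] at this
      rw [mem_compl_iff, mem_ball, not_lt, dist_eq_norm]
      have hst : Real.sqrt (-t) ≤ Real.sqrt (-τ) := Real.sqrt_le_sqrt (by linarith)
      nlinarith [norm_sub_norm_le y x, hM.le]
    have hL := lintegral_env_mul_enorm_le hσ hD x (hv.aestronglyMeasurable_slice hτ0)
    have hL6' := hL6 τ hτ0
    calc ∫⁻ y in Ring, ENNReal.ofReal (C₀ * ((t - τ) + ‖x - y‖ ^ 2) ^ (-(2 : ℝ))) *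
            indicator {z : EuclideanSpace ℝ (Fin 3) | 2 * a < ‖z‖} (fun z => ‖z‖ₑ ^ 2) (v τ y)
        ≤ ∫⁻ y in Ring, ENNReal.ofReal (C₀ * ((t - τ) + ‖x - y‖ ^ 2) ^ (-(2 : ℝ))) *
            (ENNReal.ofReal (2 * ηn * (-τ) ^ (-(1 / 2 : ℝ))) * ‖v τ y‖ₑ) :=
          setLIntegral_mono' (measurableSet_ball.diff measurableSet_ball) fun y hy =>
            mul_le_mul' le_rfl (hb y hy)
      _ ≤ ∫⁻ y in (ball x D)ᶜ, ENNReal.ofReal (C₀ * ((t - τ) + ‖x - y‖ ^ 2) ^ (-(2 : ℝ))) *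
            (ENNReal.ofReal (2 * ηn * (-τ) ^ (-(1 / 2 : ℝ))) * ‖v τ y‖ₑ) := lintegral_mono_set hsub
      _ = ENNReal.ofReal C₀ * ENNReal.ofReal (2 * ηn * (-τ) ^ (-(1 / 2 : ℝ))) *
            ∫⁻ y in (ball x D)ᶜ, ENNReal.ofReal (((t - τ) + ‖x - y‖ ^ 2) ^ (-(2 : ℝ))) * ‖v τ y‖ₑ := by
          rw [← lintegral_const_mul' _ _ (ENNReal.mul_ne_top ENNReal.ofReal_ne_top ENNReal.ofReal_ne_top)]
          refine lintegral_congr fun y => ?_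
          rw [ENNReal.ofReal_mul hC₀.le]; ring
      _ ≤ ENNReal.ofReal C₀ * ENNReal.ofReal (2 * ηn * (-τ) ^ (-(1 / 2 : ℝ))) *
            (ENNReal.ofReal (c₃ * D ^ (-(3 / 2 : ℝ))) * eLpNorm (v τ) 6 volume) := by
          gcongr
      _ ≤ ENNReal.ofReal C₀ * ENNReal.ofReal (2 * ηn * (-τ) ^ (-(1 / 2 : ℝ))) *
            (ENNReal.ofReal (c₃ * D ^ (-(3 / 2 : ℝ))) * ENNReal.ofReal (k₆ * (-τ) ^ (-(1 / 4 : ℝ)))) := by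
          gcongr
      _ = _ := by
          have hp1 : 0 ≤ 2 * ηn * (-τ) ^ (-(1 / 2 : ℝ)) := by
            have := Real.rpow_nonneg hnτ.le (-(1 / 2 : ℝ)); positivity
          have hp2 : 0 ≤ c₃ * D ^ (-(3 / 2 : ℝ)) := by
            have := Real.rpow_nonneg hD.le (-(3 / 2 : ℝ)); positivity
          have hp3 : 0 ≤ k₆ * (-τ) ^ (-(1 / 4 : ℝ)) := by
            have := Real.rpow_nonneg hnτ.le (-(1 / 4 : ℝ)); positivity
          rw [← ENNReal.ofReal_mul hp2, ← ENNReal.ofReal_mul hC₀.le, ← ENNReal.ofReal_mul (mul_nonneg hC₀.le hp1)]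
          congr 1
          have e : (-τ) ^ (-(1 / 2 : ℝ)) * (-τ) ^ (-(1 / 4 : ℝ)) = (-τ) ^ (-(3 / 4 : ℝ)) := by
            rw [← Real.rpow_add hnτ]; norm_num
          calc C₀ * (2 * ηn * (-τ) ^ (-(1 / 2 : ℝ))) * (c₃ * D ^ (-(3 / 2 : ℝ)) * (k₆ * (-τ) ^ (-(1 / 4 : ℝ))))
              = 2 * ηn * C₀ * c₃ * D ^ (-(3 / 2 : ℝ)) * k₆ * ((-τ) ^ (-(1 / 2 : ℝ)) * (-τ) ^ (-(1 / 4 : ℝ))) := by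
                ring
            _ = _ := by rw [e]
  -- integrate in time
  have hconst : 0 ≤ 2 * ηn * C₀ * c₃ * D ^ (-(3 / 2 : ℝ)) * k₆ := by
    have := Real.rpow_nonneg hD.le (-(3 / 2 : ℝ)); positivity
  calc ∫⁻ τ in Ioo t₁ t, ∫⁻ y in ball (0 : EuclideanSpace ℝ (Fin 3)) (Rn + M * Real.sqrt (-τ)) \
          ball 0 (Rn1 + M * Real.sqrt (-τ)),
          ENNReal.ofReal (C₀ * ((t - τ) + ‖x - y‖ ^ 2) ^ (-(2 : ℝ))) *
            indicator {z : EuclideanSpace ℝ (Fin 3) | 2 * a < ‖z‖} (fun z => ‖z‖ₑ ^ 2) (v τ y)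
      ≤ ∫⁻ τ in Ioo t₁ t, ENNReal.ofReal ((2 * ηn * C₀ * c₃ * D ^ (-(3 / 2 : ℝ)) * k₆) * (-τ) ^ (-(3 / 4 : ℝ))) :=
        setLIntegral_mono' measurableSet_Ioo hslice
    _ = ENNReal.ofReal (2 * ηn * C₀ * c₃ * D ^ (-(3 / 2 : ℝ)) * k₆) *
          ∫⁻ τ in Ioo t₁ t, ENNReal.ofReal ((-τ) ^ (-(3 / 4 : ℝ))) := by
        rw [← lintegral_const_mul' _ _ ENNReal.ofReal_ne_top]
        exact lintegral_congr fun τ => ENNReal.ofReal_mul hconst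
    _ ≤ ENNReal.ofReal (2 * ηn * C₀ * c₃ * D ^ (-(3 / 2 : ℝ)) * k₆) *
          ENNReal.ofReal ((-t₁) ^ (1 - (3 / 4 : ℝ)) / (1 - 3 / 4)) := by
        gcongr
        exact lintegral_Ioo_neg_rpow_le (by norm_num) ht₁ ht.le
    _ = _ := by
        rw [← ENNReal.ofReal_mul hconst]
        congr 1
        rw [show (1 : ℝ) - 3 / 4 = 1 / 4 by norm_num]
        ring

end Summit.NavierStokesRegularity.NavierStokesRegularity.Theorems.RecurrentReductionD

end
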